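import Summits.Ventures.PackingBounds.ThreePointCert.SoundNN
import Summits.Ventures.PackingBounds.ThreePointCert.CheckKSP
import Summits.Ventures.PackingBounds.ThreePointCert.CheckFKSSound
import Summits.Ventures.PackingBounds.ThreePointCert.CheckIdKSSound
import Summits.Ventures.PackingBounds.ThreePointCert.K13d14pExpandKS1
import Summits.Ventures.PackingBounds.ThreePointCert.K13d14pExpandKS2
import Summits.Ventures.PackingBounds.ThreePointCert.K13d14pExpandKS3
import Summits.Ventures.PackingBounds.ThreePointCert.K13d14pExpandKS4
import Summits.Ventures.PackingBounds.ThreePointCert.K13d14pExpandKS5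
import Summits.Ventures.PackingBounds.ThreePointCert.K13d14pExpandKS6
import Summits.Ventures.PackingBounds.ThreePointCert.K13d14pExpandKS7
import Summits.Ventures.PackingBounds.ThreePointCert.K13d14pExpandKS8
import Summits.Ventures.PackingBounds.ThreePointCert.K13d14pExpandKS9
import Summits.Ventures.PackingBounds.ThreePointCert.K13d14pExpandF
import Summits.Ventures.PackingBounds.ThreePointCert.K13d14pCheckId

/-!
# κ(13) ≤ 2069: the kernel-checked theorem

Framing: lottery ticket; floor = certified bounds/negative ranges. Venture `PackingBounds` (cell
`pub-packcert`), three-point SDP family, kissing column. Integer data / kernel checks of a feasible point of the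
Bachoc–Vallentin semidefinite program (n = 13, s = 1/2, three-point matrix degree 14, two-point (Gegenbauer) part to
degree L = 28, Bachoc–Vallentin multiplier set = cell mode sym2; exact rational certificate `sdp-n13-d14-s1-2-sym2-a28-hyb8dd-j155390.json`
(sha256 f3bd2120ef6b3f7462b1c9710407160f3cb5333468dd4a4a85b403a137826c8c) of the sdp seat's hybrid pipeline, verified by the cell's two exact verifiers), converted by
`cert2lean_g9.py` (lp gen 9; S = 74) into the units of the kernel checker `ThreePointCert.Check` + `CheckSym2` with the
record degree field set to L = 28 (the checker's degree enters only the unit `W = 2^d·d!` and the side conditions, so a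
(d, L) certificate is a `Cert3` of degree L); symmetry-adapted PARTS (S₃/S₂ isotypic bases of short polynomials) with coarse factor COLUMNS, validated by
Kronecker substitution `ThreePointCert.CheckKSP` (`sosCheckKSParts`: the claimed expansion and `Σ_parts Σ_k col_k²` compared at `(2^w, 2^{wD}, 2^{wD²})`); three-point part by `CheckFKS`;
split check of (ii') `ThreePointCert.CheckSym2Split`. Emitter `emitlean_ks3.py` (lp gen 10; expansions `4^k • Σ_parts pᵀ(L′L′ᵀ)p` lifted by `SoundNN.boxNonneg_smul`). Generated file: plain lists of integers / monomials.
-/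

namespace Summit.Ventures.PackingBounds.ThreePointCert.K13d14p

open Literature.Geometry.DiscreteGeometry Literature.Geometry.DiscreteGeometry.PolyCert PolyCert.SPoly

set_option maxRecDepth 100000 in
/-- The expansion data are valid in the weak sense of `SoundNN.PolysNN3` (Gram expansions by `CheckKSP.boxNonneg_of_sosCheckKSParts` over the symmetry-adapted parts, scaled by `boxNonneg_smul`; `FI` by `CheckFKS.fexpValidG_of_fCheckKS`). -/
theorem polys_nn : PolysNN3 K13d14p.cert K13d14p.polys where
  hF := fexpValidG_of_fCheckKS _ _ cert eFP vF
  h0 := boxNonneg_smul cR0 eR0s (boxNonneg_append _ _ (boxNonneg_append _ _ (boxNonneg_append _ _ (boxNonneg_of_sosCheckKSParts _ _ _ _ _ vR0ptrv) (boxNonneg_of_sosCheckKSParts _ _ _ _ _ vR0palt)) (boxNonneg_append _ _ (boxNonneg_append _ _ (boxNonneg_of_sosCheckKSParts _ _ _ _ _ vR0pstdAg1) (boxNonneg_of_sosCheckKSParts _ _ _ _ _ vR0pstdAg2)) (boxNonneg_of_sosCheckKSParts _ _ _ _ _ vR0pstdAg3))) (boxNonneg_append _ _ (boxNonneg_append _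 _ (boxNonneg_of_sosCheckKSParts _ _ _ _ _ vR0pstdBg1) (boxNonneg_of_sosCheckKSParts _ _ _ _ _ vR0pstdBg2)) (boxNonneg_of_sosCheckKSParts _ _ _ _ _ vR0pstdBg3)))
  h1 := boxNonneg_smul cR1 eR1s (boxNonneg_append _ _ (boxNonneg_append _ _ (boxNonneg_append _ _ (boxNonneg_append _ _ (boxNonneg_of_sosCheckKSParts _ _ _ _ _ vR1psymg1) (boxNonneg_of_sosCheckKSParts _ _ _ _ _ vR1psymg2)) (boxNonneg_of_sosCheckKSParts _ _ _ _ _ vR1psymg3)) (boxNonneg_of_sosCheckKSParts _ _ _ _ _ vR1psymg4)) (boxNonneg_append _ _ (boxNonneg_append _ _ (boxNonneg_of_sosCheckKSParts _ _ _ _ _ vR1pantig1) (boxNonneg_of_sosCheckKSParts _ _ _ _ _ vR1pantig2)) (boxNonneg_of_sosCheckKSParts _ _ _ _ _ vR1pantig3)))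
  h2 := boxNonneg_smul cR2 eR2s (boxNonneg_of_sosCheckKSParts _ _ _ _ _ vR2)
  h3 := boxNonneg_smul cR3 eR3s (boxNonneg_of_sosCheckKSParts _ _ _ _ _ vR3)
  h4 := boxNonneg_smul cR4 eR4s (boxNonneg_of_sosCheckKSParts _ _ _ _ _ vR4)
  hq0 := boxNonneg_smul cQ0 eQ0s (boxNonneg_of_sosCheckKSParts _ _ _ _ _ vQ0)
  hq1 := boxNonneg_smul cQ1 eQ1s (boxNonneg_of_sosCheckKSParts _ _ _ _ _ vQ1)

set_option maxHeartbeats 0 in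
/-- The side conditions hold. -/
theorem cert_side : checkSide3 K13d14p.cert = true := by decide +kernel

set_option maxHeartbeats 0 in
/-- The numerical bound is `< N + 1` (and `≥ 0`). -/
theorem cert_bound : checkBound3 K13d14p.cert K13d14p.polys = true := by decide +kernel

/-- **κ(13) ≤ 2069**: every finite set of unit vectors of `ℝ^13` with pairwise inner products
`≤ 1 / 2` has at most `2069` elements (kissing configurations of `ℝ^13`) — the Bachoc–Vallentin three-point (semidefinite
programming) bound with their original multiplier set, three-point matrix degree 14 with the two-point (Gegenbauer)
part to degree 28 (the sdp seat's hybrid pipeline, cell family hyb8dd), from the exact certificate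
`sdp-n13-d14-s1-2-sym2-a28-hyb8dd-j155390.json` (bound value 2069.608629), kernel-checked (record degree field `d := 28`; symmetry-adapted parts with coarse Gram factors lifted by `SoundNN`; Gram expansions by Kronecker substitution `CheckKSP`, three-point part by `CheckFKS`, identities (i')/(ii') by `CheckIdKS`).
[cite: BachocVallentin2007, Theorem 4.2] -/
theorem kissing_dim13_le_2069_sdp (C : Finset (EuclideanSpace ℝ (Fin 13)))
    (h1 : ∀ x ∈ C, ‖x‖ = 1) (h2 : ∀ x ∈ C, ∀ y ∈ C, x ≠ y → inner ℝ x y ≤ 1 / 2) :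
    C.card ≤ 2069 :=
  card_le_of_cert3KS _ _ _ _ cert polys polys_nn rhoI rhoII cert_idI cert_idII cert_side cert_bound C h1
    (fun x hx y hy hxy => by
      have h := h2 x hx y hy hxy
      have e : ((cert.p : ℤ) : ℝ) / (cert.q : ℕ) = 1 / 2 := by norm_num [cert]
      rw [e]; exact h)

end Summit.Ventures.PackingBounds.ThreePointCert.K13d14p
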